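import Summits.CriticalPhenomena.CardyFormulaZ2.Theorems.CardyAnchoredRigiditySubseqCardyJointLimit

/-!
# Stub `stub_jointPrecompactness` of crux `SubseqConformalInvariance` (stmt-CriticalPhenomena-8266),
# line `birth` — joint sequential precompactness of the bond-`ℤ²` crossing functions

Route `CardyMirrorMonotone`, sub-problem `CardyFormulaZ2`, summit `CriticalPhenomena`. The registered
stub S3 of the birth skeleton `Cruxes/SubseqConformalInvariance/Lines/birth.lean`:

  every sequence of meshes `u → 0⁺` has a subsequence `u ∘ φ` along which the `P_{1/2}` bond-`ℤ²`
  crossing probability `bondDomainCrossingProb R (u (φ n))` of EVERY conformal rectangle `R` converges,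
  to some `L : ConformalRectangle → ℝ`.

This is, verbatim, the precompactness theorem `exists_strictMono_jointLimit` proved for the crux
`SubseqCardy` (stmt-CriticalPhenomena-5768, line `registered`, file
`Theorems/CardyAnchoredRigiditySubseqCardyJointLimit.lean`): Cantor's diagonal over a countable family
of rectangles (`exists_strictMono_forall_tendsto_real`) + the `ε/3` Cauchy argument + countable UNIFORM
approximability of the crossing functions (`stub_countableApprox`: separability of the plane
homeomorphisms for compact convergence, Schramm–Smirnov 2011 Lemma 5.1 domain perturbation for crude
crossings, and the bond ≈ crude sandwich `stub_bondNearCrude`). No PPI, no conformal invariance.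

References: O. Schramm, S. Smirnov, *On the scaling limits of planar percolation*, Ann. Probab. 39
(2011) §1.3, §5; M. Aizenman, A. Burchard, Duke Math. J. 99 (1999) (tightness); G. Grimmett,
*Percolation* (1999) §11.7.
-/

namespace Summit.CriticalPhenomena.CardyFormulaZ2.Cruxes.SubseqConformalInvariance.Birth

/-- **S3 `stub_jointPrecompactness` (crux `SubseqConformalInvariance`, stmt-CriticalPhenomena-8266,
line `birth`) — PROVED.** Every sequence of meshes `u n → 0⁺` has a subsequence `u ∘ φ` along which,
for EVERY conformal rectangle `R`, the bond-`ℤ²` crossing probabilities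
`bondDomainCrossingProb R (u (φ n))` converge (to some `L R`). This is the precompactness theorem
`Summit.CriticalPhenomena.CardyFormulaZ2.Cruxes.SubseqCardy.Birth.exists_strictMono_jointLimit`
of the sibling crux `SubseqCardy` (stmt-CriticalPhenomena-5768), restated under the registered
stub name. [folklore] -/
theorem stub_jointPrecompactness :
    ∀ u : ℕ → ℝ, Filter.Tendsto u Filter.atTop (nhdsWithin (0 : ℝ) (Set.Ioi 0)) →
      ∃ φ : ℕ → ℕ, StrictMono φ ∧
        ∃ L : Literature.Probability.RandomPlanarGeometry.ConformalRectangle → ℝ,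
          ∀ R : Literature.Probability.RandomPlanarGeometry.ConformalRectangle,
            Filter.Tendsto
              (fun n => Literature.Probability.Percolation.bondDomainCrossingProb R (u (φ n)))
              Filter.atTop (nhds (L R)) :=
  Summit.CriticalPhenomena.CardyFormulaZ2.Cruxes.SubseqCardy.Birth.exists_strictMono_jointLimit

end Summit.CriticalPhenomena.CardyFormulaZ2.Cruxes.SubseqConformalInvariance.Birth
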